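/-
Origin: expansion seat `planner-pub-hodgecm-prl1-g4-0`, handover #1 2026-08-18T07:12:45Z (`HOME/pub-hodgecm-prl1-g4/lean/Prl1g4/WeilThetaModel.lean`, md5 7a7c816c, 324 lines);
landed by the gen-7 packager in gate run 25 as `HodgeCM/Automorphic/WeilThetaModel.lean` (verbatim).
-/
/-
Origin: HOME/pub-hodgecm-prl1-g4/lean/Prl1g4/WeilThetaModel.lean — session planner-pub-hodgecm-prl1-g4-0
(unit pub-hodgecm-prl1-g4, EXPANSION PROVER a-1 gen 4, STRATEGY 1 CONSTRUCT; lineage prl1).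
Intended final place (packager's call): `HodgeCM/Automorphic/WeilThetaModel.lean`.
NEW, ADDITIVE LEAF; imports the LANDED Literature module `HodgeCM.Literature.WeilTheta1964` only (which imports
`Mathlib`); no import rewrite.  KIND: KERNEL over PRINT-BY-NAME — nothing of the 2001 programme, of PerL or of QW8
is cited or used.
-/
import Summits.HodgeConjecture.HodgeCM.Literature.WeilTheta1964

/-!
# The Weil theta model: the kernel family `θ_Φ`, the action `ω(h)` and their three STRUCTURAL laws,
# CONSTRUCTED from Weil 1964 (n° 39, n° 41 Théorème 6) and the dual-pair splitting

The kernel model of the theta carrier (pv15-g2, `HodgeCM/Automorphic/KernelCarrier.lean`,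
`KernelModelCarrier.lean`, run 25) takes as prop-free DATA, per seesaw context, an index space `𝒮^κ` with a
topology, a map `ω : U(W)(𝔸) → 𝒮^κ → 𝒮^κ` and a kernel family `θ : 𝒮^κ → C([G_U] × [U(W)], ℂ)`, and as its only
non-analytic HYPOTHESES the three STRUCTURAL laws (`KernelModelThetaData.Structural`):

* `omg_one : ω(1)Φ = Φ`;
* `θ_cont  : Φ ↦ θ_Φ` is continuous into `C([G_U] × [U(W)], ℂ)` (PerL v5 l. 343 / l. 381 — flagged
  "PRINT-DERIVED, not a numbered statement; not typed" in `HodgeCM/Literature/WeilTheta1964.lean`);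
* `θ_omg   : θ_{ω(h)Φ}(ξ, q) = θ_Φ(ξ, h⁻¹ • q)` (PerL v5 l. 414).

Here all three are THEOREMS (`WeilThetaModel.omg_one`, `.θ_cont`, `.θ_omg`, bundled as `.structural_laws`)
of a model ONE LEVEL DOWN, `WeilThetaModel GU ΓU G Γ`, whose content is, with the labels of the cell:

* **P (carriers)** a `Literature.Theta.WeilThetaDatum` `W`: `Mp(X)_A`, `S(X_A)`, `(S, Φ) ↦ SΦ`, `r_k(Ps(X)_k)`,
  `Θ` [We64, Chap. III n° 37–41]; and `act_one : 1·Φ = Φ` (the unit of `Mp(X)_A` acts trivially);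
* **DEF + P** `theta_act : Θ_{S'Φ}(S) = Θ_Φ(S S')` — Weil's DEFINITION of `Θ` [n° 41, p. 193:
  "`Θ(S) = Σ_{ξ ∈ X_k} (SΦ)(ξ)`"] together with `S(S'Φ) = (SS')Φ` (n° 37: `S ↦ (Φ ↦ SΦ)` is a representation);
* **PRINT BY NAME** `W.ActionContinuous` [n° 39, p. 189: joint continuity of `(S, Φ) ↦ SΦ`] and
  `W.ThetaContinuousInvariant` [n° 41, **Théorème 6**, p. 193: `S ↦ Θ_Φ(S)` continuous and invariant under left
  translation by `r_k(s)`, `s ∈ Ps(X)_k`] — both typed verbatim, with page and line, in `WeilTheta1964.lean`;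
* **PRINT-DERIVED** `dist_cont` : the theta distribution `Φ ↦ Θ_Φ(1) = Σ_{ξ ∈ X_k} Φ(ξ)` is continuous on
  `S(X_A)` [We64 p. 194 L26–35, proof of Théorème 6: termwise continuity "`Φ → Φ(x₀)` est une application
  continue de `S(X_A)` dans `ℂ`" + Lemme 5 domination; = the content of PerL l. 343];
* **class U** (print, not held verbatim — exactly as in pv11-g3's `HodgeCM/PerL34/WeilKernelLaw.lean`): the
  dual-pair splitting `s : G_U(𝔸) × U(W)(𝔸) → Mp(𝕎)_A` is a continuous homomorphism carrying the rational points
  `G_U(L⁺) × U(W)(L₀)` into `r_k(Ps_k)` ([Ku94 §§ 1, 3–4]; [HKS96 § 1, (1.14)–(1.16) =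
  `Literature.Theta.HKSSplittingDatum.beta`] for the mechanism; the print home of the rational-points clause is
  [GQT14 § 11.2 p. 33]: automorphy of the `χ`-normalised theta kernel ⇒ `s_χ|_{H(L₀)} = can`, GAPS adv4g4-C12 —
  anchors as corrected by the theta-literature seat cf-kudla-howe-rallis-g4, STATUS 07:13:11Z);
* **DEF** `SK ⊆ S(X_A)` — the index space `𝒮^κ` (PerL l. 341) — stable under `s(1 × U(W)(𝔸))`.

CONSTRUCTED (§§ 2–4): `ω(h)Φ := s(1, h)·Φ` on `SK`; the kernel upstairs
`thetaFun Φ (x, y) := Θ_Φ(s(x, y)⁻¹)` on `G_U × G`, right-`ΓU × Γ`-invariant by Théorème 6 (conjunct 2), hence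
DESCENDED to `θ_Φ ∈ C((GU ⧸ ΓU) × (G ⧸ Γ), ℂ)` (continuity by Théorème 6, conjunct 1, along `s`).
PROVED (§ 5): `omg_one`; `θ_cont : Continuous θ` (compact-open topology; joint continuity of
`(Φ, x, y) ↦ Θ_{s(x,y)⁻¹Φ}(1)` by n° 39 and `dist_cont`, pushed through the open quotient map
`id × mk × mk` and curried); `θ_omg`.

CONVENTION (the only non-obvious point).  Mathlib's `G ⧸ Γ` is the space of LEFT cosets `gΓ` — functions on
it are the RIGHT-`Γ`-invariant functions of `g`, and `G` acts on it on the left (`h • gΓ = (hg)Γ`) — whereas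
the automorphic quotient `[U(W)] = U(W)(L₀)\U(W)(𝔸)` consists of right cosets with `U(W)(𝔸)` acting by right
translation.  The dictionary is `g ↦ g⁻¹`: it turns Weil's LEFT invariance under rational elements
(Théorème 6) into right-`Γ`-invariance, and PerL's law `θ_Φ(g, yh) = θ_{ω(h)Φ}(g, y)` (l. 414) into the kernel
model's `θ_{ω(h)Φ}(ξ, q) = θ_Φ(ξ, h⁻¹ • q)` — which is why the kernel upstairs is evaluated at `s(x, y)⁻¹`
(cf. `KernelTorusCarrier.pt t := mk (jT t)⁻¹` in `KernelCarrier.lean`).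

NOT CLAIMED: that `W` IS the adelic metaplectic group of `𝕎 = Res(V ⊗ W)` with its Schwartz–Bruhat space (no
adelic metaplectic groups in Mathlib: the carriers stay abstract, as everywhere in this package); conservativity
(the model is a STRENGTHENING of the structural triple: it also carries the `G_U`-action, which the kernel model
does not see).  The junction with pv15-g2's `KernelModelThetaData` (the END STATE with no structural hypothesis)
is a separate file landing after `HodgeCM.Automorphic.KernelModelAnnihilation`.
-/

set_option autoImplicit false

noncomputable section

open Topology

namespace HodgeCM

open Literature.Theta

/-! ## 1. The model -/

/-- **Weil theta model** for a pair of quotients `GU ⧸ ΓU` (`= [G_U]`) and `G ⧸ Γ` (`= [U(W)]`): a Weil datum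
`W` [We64] with the unit law of its action, Weil's definition of `Θ` as "distribution after action", the two
PRINT facts n° 39 / Théorème 6 BY NAME, the continuity of the theta distribution, the dual-pair splitting
`s : GU × G →* Mp(X)_A` (continuous, rational points to `r_k(Ps_k)`), and the index space `SK ⊆ S(X_A)` stable
under `s(1 × G)`. -/
structure WeilThetaModel (GU : Type) [Group GU] [TopologicalSpace GU] (ΓU : Subgroup GU)
    (G : Type) [Group G] [TopologicalSpace G] (Γ : Subgroup G) where
  /-- P (carriers of [We64, n° 37–41]): `Mp(X)_A`, `S(X_A)`, `act`, `rat = r_k(Ps(X)_k)`, `theta` -/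
  W : WeilThetaDatum.{0}
  /-- P: the unit of `Mp(X)_A` acts trivially on `S(X_A)` -/
  act_one : ∀ Φ : W.SX, W.act 1 Φ = Φ
  /-- DEF [n° 41 p. 193, `Θ(S) = Σ_{ξ ∈ X_k} (SΦ)(ξ)`] + P [n° 37, `S(S'Φ) = (SS')Φ`]: `Θ_{S'Φ}(S) = Θ_Φ(SS')` -/
  theta_act : ∀ (Φ : W.SX) (S S' : W.Mp), W.theta (W.act S' Φ) S = W.theta Φ (S * S')
  /-- PRINT BY NAME [We64, n° 39, p. 189]: `(S, Φ) ↦ SΦ` is jointly continuous -/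
  actionContinuous : W.ActionContinuous
  /-- PRINT BY NAME [We64, n° 41, Théorème 6, p. 193]: `S ↦ Θ_Φ(S)` continuous, left-`r_k(Ps_k)`-invariant -/
  thetaContinuousInvariant : W.ThetaContinuousInvariant
  /-- PRINT-DERIVED [We64 p. 194 L26–35; PerL v5 l. 343]: the theta distribution `Φ ↦ Θ_Φ(1)` is continuous -/
  dist_cont : Continuous fun Φ : W.SX => W.theta Φ 1
  /-- class U [Ku94 § 1, HKS96 § 1]: the dual-pair splitting `G_U(𝔸) × U(W)(𝔸) → Mp(𝕎)_A`, a homomorphism … -/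
  s : GU × G →* W.Mp
  /-- … continuous … -/
  s_cont : Continuous s
  /-- … carrying the rational points `G_U(L⁺) × U(W)(L₀)` into `r_k(Ps_k)` [GQT14 § 11.2 p. 33 (adv4g4-C12);
  mechanism HKS96 (1.14)–(1.16) = `Literature.Theta.HKSSplittingDatum.beta`, Ku94 §§ 3–4] -/
  s_rat : ∀ γU ∈ ΓU, ∀ γ ∈ Γ, s (γU, γ) ∈ W.rat
  /-- DEF (PerL l. 341): the index space `𝒮^κ ⊆ S(X_A)` … -/
  SK : Set W.SX
  /-- … stable under `ω(h) = s(1, h)`, `h ∈ U(W)(𝔸)` -/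
  SK_stable : ∀ (h : G) (Φ : W.SX), Φ ∈ SK → W.act (s (1, h)) Φ ∈ SK

namespace WeilThetaModel

variable {GU : Type} [Group GU] [TopologicalSpace GU] {ΓU : Subgroup GU}
variable {G : Type} [Group G] [TopologicalSpace G] {Γ : Subgroup G}
variable (M : WeilThetaModel GU ΓU G Γ)

/-! ## 2. The Weil action `ω(h)` on `𝒮^κ` -/

/-- **`ω(h)Φ := s(1, h)·Φ`** on the index space `SK`. -/
def omg (h : G) (Φ : M.SK) : M.SK :=
  ⟨M.W.act (M.s (1, h)) Φ.1, M.SK_stable h Φ.1 Φ.2⟩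

/-- (Ported verbatim from the HodgeCMPerL package; no docstring in the source.) -/
@[simp] theorem coe_omg (h : G) (Φ : M.SK) : (M.omg h Φ : M.W.SX) = M.W.act (M.s (1, h)) Φ.1 := rfl

/-- **STRUCTURAL LAW 1 (`omg_one`)**: `ω(1)Φ = Φ` — from `s(1) = 1` and the unit law of the action. -/
theorem omg_one (Φ : M.SK) : M.omg 1 Φ = Φ := by
  apply Subtype.ext
  have h1 : ((1 : GU), (1 : G)) = (1 : GU × G) := rfl
  simp only [coe_omg, h1, map_one, M.act_one]

/-- `ω` is multiplicative up to the action law it inherits: `ω(h h')Φ` is `s(1,h)·(s(1,h')·Φ)` as soon as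
`act` is (pointwise) multiplicative on the elements concerned — recorded in the form the kernel needs, namely
through `Θ`: `Θ_{ω(hh')Φ}(S) = Θ_{ω(h')Φ}(S·s(1,h))`. -/
theorem theta_omg_mul (h h' : G) (Φ : M.SK) (S : M.W.Mp) :
    M.W.theta (M.omg (h * h') Φ : M.W.SX) S = M.W.theta (M.omg h' Φ : M.W.SX) (S * M.s (1, h)) := by
  have hp : ((1 : GU), h * h') = ((1 : GU), h) * ((1 : GU), h') := by simp
  simp only [coe_omg, M.theta_act, hp, map_mul, mul_assoc]

/-! ## 3. The kernel upstairs: `(x, y) ↦ Θ_Φ(s(x, y)⁻¹)` on `G_U × G` -/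

/-- The theta kernel pulled back to `GU × G` in Mathlib's coset convention: `thetaFun Φ (x, y) = Θ_Φ(s(x,y)⁻¹)`. -/
def thetaFun (Φ : M.W.SX) (p : GU × G) : ℂ :=
  M.W.theta Φ (M.s p⁻¹)

/-- (Ported verbatim from the HodgeCMPerL package; no docstring in the source.) -/
theorem thetaFun_apply (Φ : M.W.SX) (p : GU × G) : M.thetaFun Φ p = M.W.theta Φ (M.s p⁻¹) := rfl

/-- `Θ_Φ(s(p)⁻¹) = Θ_{s(p)⁻¹Φ}(1)`: the kernel is the theta DISTRIBUTION of the translated function. -/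
theorem thetaFun_eq_dist (Φ : M.W.SX) (p : GU × G) :
    M.thetaFun Φ p = M.W.theta (M.W.act (M.s p⁻¹) Φ) 1 := by
  rw [thetaFun, M.theta_act, one_mul]

/-- Continuity of the kernel in the group variables (Théorème 6, conjunct 1, along the continuous splitting). -/
theorem continuous_thetaFun [ContinuousInv GU] [ContinuousInv G] (Φ : M.W.SX) :
    Continuous (M.thetaFun Φ) :=
  M.thetaContinuousInvariant.theta_comp_continuous Φ (M.s_cont.comp continuous_inv)

/-- **Joint continuity** of `(Φ, x, y) ↦ Θ_Φ(s(x,y)⁻¹)` on `S(X_A) × (G_U × G)`: n° 39 (joint continuity of the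
action) composed with the continuity of the theta distribution. -/
theorem continuous_thetaFun_uncurry [ContinuousInv GU] [ContinuousInv G] :
    Continuous fun q : M.W.SX × (GU × G) => M.thetaFun q.1 q.2 := by
  have hact : Continuous fun q : M.W.SX × (GU × G) => M.W.act (M.s q.2⁻¹) q.1 := by
    have h := M.actionContinuous
    unfold WeilThetaDatum.ActionContinuous at h
    exact h.comp (((M.s_cont.comp continuous_inv).comp continuous_snd).prodMk continuous_fst)
  simpa only [thetaFun_eq_dist, Function.comp_def] using M.dist_cont.comp hact

/-- **Right `ΓU × Γ`-invariance** of the kernel upstairs (Théorème 6, conjunct 2, and `s(ΓU × Γ) ⊆ r_k(Ps_k)`). -/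
theorem thetaFun_mul_right (Φ : M.W.SX) (p : GU × G) {γU : GU} (hγU : γU ∈ ΓU) {γ : G} (hγ : γ ∈ Γ) :
    M.thetaFun Φ (p * (γU, γ)) = M.thetaFun Φ p := by
  have hrat : M.s (γU, γ)⁻¹ ∈ M.W.rat := by
    rw [Prod.inv_mk]
    exact M.s_rat γU⁻¹ (inv_mem hγU) γ⁻¹ (inv_mem hγ)
  simp only [thetaFun, mul_inv_rev, map_mul]
  exact M.thetaContinuousInvariant.theta_left_invariant Φ hrat _

/-- (Ported verbatim from the HodgeCMPerL package; no docstring in the source.) -/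
theorem thetaFun_mul_right_U (Φ : M.W.SX) (x : GU) (y : G) {γU : GU} (hγU : γU ∈ ΓU) :
    M.thetaFun Φ (x * γU, y) = M.thetaFun Φ (x, y) := by
  simpa using M.thetaFun_mul_right Φ (x, y) hγU (one_mem Γ)

/-- (Ported verbatim from the HodgeCMPerL package; no docstring in the source.) -/
theorem thetaFun_mul_right_W (Φ : M.W.SX) (x : GU) (y : G) {γ : G} (hγ : γ ∈ Γ) :
    M.thetaFun Φ (x, y * γ) = M.thetaFun Φ (x, y) := by
  simpa using M.thetaFun_mul_right Φ (x, y) (one_mem ΓU) hγ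

/-! ## 4. Descent to `(GU ⧸ ΓU) × (G ⧸ Γ)` -/

section Descend

variable {H : Type} [Group H] (Δ : Subgroup H) {Z : Type}

/-- Descend a right-`Δ`-invariant function on `H` to Mathlib's coset space `H ⧸ Δ`. -/
def descend (f : H → Z) (hf : ∀ (g : H), ∀ γ ∈ Δ, f (g * γ) = f g) : H ⧸ Δ → Z :=
  Quotient.lift (s := QuotientGroup.leftRel Δ) f (by
    intro a b hab
    have hab' : a⁻¹ * b ∈ Δ := QuotientGroup.leftRel_apply.mp hab
    simpa using (hf a (a⁻¹ * b) hab').symm)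

/-- (Ported verbatim from the HodgeCMPerL package; no docstring in the source.) -/
@[simp] theorem descend_mk (f : H → Z) (hf : ∀ (g : H), ∀ γ ∈ Δ, f (g * γ) = f g) (g : H) :
    descend Δ f hf (QuotientGroup.mk g) = f g := rfl

/-- (Ported verbatim from the HodgeCMPerL package; no docstring in the source.) -/
theorem descend_comp_mk (f : H → Z) (hf : ∀ (g : H), ∀ γ ∈ Δ, f (g * γ) = f g) :
    descend Δ f hf ∘ QuotientGroup.mk = f := rfl

end Descend

/-- The descended kernel as a bare function on `(GU ⧸ ΓU) × (G ⧸ Γ)`. -/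
def thetaQuot (Φ : M.W.SX) : (GU ⧸ ΓU) × (G ⧸ Γ) → ℂ := fun q =>
  descend ΓU
    (fun x => descend Γ (fun y => M.thetaFun Φ (x, y)) (fun y γ hγ => M.thetaFun_mul_right_W Φ x y hγ) q.2)
    (by
      intro x γU hγU
      induction q.2 using QuotientGroup.induction_on with
      | H y => simp only [descend_mk, M.thetaFun_mul_right_U Φ x y hγU])
    q.1

/-- (Ported verbatim from the HodgeCMPerL package; no docstring in the source.) -/
@[simp] theorem thetaQuot_mk (Φ : M.W.SX) (x : GU) (y : G) :
    M.thetaQuot Φ (QuotientGroup.mk x, QuotientGroup.mk y) = M.thetaFun Φ (x, y) := rfl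

/-- The projection `S(X_A) × (GU × G) → S(X_A) × ((GU ⧸ ΓU) × (G ⧸ Γ))` is an open quotient map. -/
theorem isOpenQuotientMap_proj [SeparatelyContinuousMul GU] [SeparatelyContinuousMul G] :
    IsOpenQuotientMap (Prod.map (id : M.W.SX → M.W.SX)
      (Prod.map (QuotientGroup.mk : GU → GU ⧸ ΓU) (QuotientGroup.mk : G → G ⧸ Γ))) :=
  IsOpenQuotientMap.id.prodMap
    (QuotientGroup.isOpenQuotientMap_mk.prodMap QuotientGroup.isOpenQuotientMap_mk)

/-- **Joint continuity downstairs**: `(Φ, ξ, q) ↦ θ_Φ(ξ, q)` is continuous on `S(X_A) × ([G_U] × [U(W)])`. -/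
theorem continuous_thetaQuot_uncurry [IsTopologicalGroup GU] [IsTopologicalGroup G] :
    Continuous fun q : M.W.SX × ((GU ⧸ ΓU) × (G ⧸ Γ)) => M.thetaQuot q.1 q.2 := by
  rw [M.isOpenQuotientMap_proj.isQuotientMap.continuous_iff]
  have heq : (fun q : M.W.SX × ((GU ⧸ ΓU) × (G ⧸ Γ)) => M.thetaQuot q.1 q.2) ∘
      Prod.map (id : M.W.SX → M.W.SX)
        (Prod.map (QuotientGroup.mk : GU → GU ⧸ ΓU) (QuotientGroup.mk : G → G ⧸ Γ)) =
      fun q : M.W.SX × (GU × G) => M.thetaFun q.1 q.2 := by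
    funext q
    rfl
  rw [heq]
  exact M.continuous_thetaFun_uncurry

/-- Continuity downstairs for fixed `Φ` (this one needs Théorème 6 only, not `dist_cont`). -/
theorem continuous_thetaQuot [IsTopologicalGroup GU] [IsTopologicalGroup G] (Φ : M.W.SX) :
    Continuous (M.thetaQuot Φ) := by
  have hπ : IsOpenQuotientMap
      (Prod.map (QuotientGroup.mk : GU → GU ⧸ ΓU) (QuotientGroup.mk : G → G ⧸ Γ)) :=
    QuotientGroup.isOpenQuotientMap_mk.prodMap QuotientGroup.isOpenQuotientMap_mk
  rw [hπ.isQuotientMap.continuous_iff]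
  have heq : M.thetaQuot Φ ∘
      Prod.map (QuotientGroup.mk : GU → GU ⧸ ΓU) (QuotientGroup.mk : G → G ⧸ Γ) = M.thetaFun Φ := by
    funext p
    rfl
  rw [heq]
  exact M.continuous_thetaFun Φ

variable [IsTopologicalGroup GU] [IsTopologicalGroup G]

/-- **The theta kernels `θ_Φ ∈ C([G_U] × [U(W)], ℂ)`, `Φ ∈ 𝒮^κ` — CONSTRUCTED.** -/
def θ (Φ : M.SK) : C((GU ⧸ ΓU) × (G ⧸ Γ), ℂ) :=
  ⟨M.thetaQuot Φ.1, M.continuous_thetaQuot Φ.1⟩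

/-- (Ported verbatim from the HodgeCMPerL package; no docstring in the source.) -/
theorem θ_apply (Φ : M.SK) (q : (GU ⧸ ΓU) × (G ⧸ Γ)) : M.θ Φ q = M.thetaQuot Φ.1 q := rfl

/-- **The dictionary, on representatives**: `θ_Φ(xΓU, yΓ) = Θ_Φ(s(x, y)⁻¹) = Θ_{s(x,y)⁻¹Φ}(1)`. -/
theorem θ_mk (Φ : M.SK) (x : GU) (y : G) :
    M.θ Φ (QuotientGroup.mk x, QuotientGroup.mk y) = M.W.theta Φ.1 (M.s (x, y)⁻¹) := rfl

/-- (Ported verbatim from the HodgeCMPerL package; no docstring in the source.) -/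
theorem θ_mk_eq_dist (Φ : M.SK) (x : GU) (y : G) :
    M.θ Φ (QuotientGroup.mk x, QuotientGroup.mk y) = M.W.theta (M.W.act (M.s (x, y)⁻¹) Φ.1) 1 :=
  M.thetaFun_eq_dist Φ.1 (x, y)

/-! ## 5. The three structural laws -/

/-- **STRUCTURAL LAW 2 (`θ_cont`)**: `Φ ↦ θ_Φ` is continuous from `𝒮^κ` to `C([G_U] × [U(W)], ℂ)`
(compact-open topology = the uniform one on the compact quotients) — PerL v5 l. 343 / l. 381, DERIVED from
n° 39 + the continuity of the theta distribution. -/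
theorem θ_cont : Continuous M.θ := by
  apply ContinuousMap.continuous_of_continuous_uncurry
  have h : Continuous fun q : M.SK × ((GU ⧸ ΓU) × (G ⧸ Γ)) => M.thetaQuot q.1.1 q.2 :=
    M.continuous_thetaQuot_uncurry.comp (continuous_subtype_val.prodMap continuous_id)
  exact h

/-- **STRUCTURAL LAW 3 (`θ_omg`, PerL v5 l. 414 `θ_Φ(g, yh) = θ_{ω(h)Φ}(g, y)`)** in the coset convention:
`θ_{ω(h)Φ}(ξ, q) = θ_Φ(ξ, h⁻¹ • q)`. -/
theorem θ_omg (h : G) (Φ : M.SK) (ξ : GU ⧸ ΓU) (q : G ⧸ Γ) :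
    M.θ (M.omg h Φ) (ξ, q) = M.θ Φ (ξ, h⁻¹ • q) := by
  induction ξ using QuotientGroup.induction_on with
  | H x =>
    induction q using QuotientGroup.induction_on with
    | H y =>
      have hsm : h⁻¹ • (QuotientGroup.mk y : G ⧸ Γ) = QuotientGroup.mk (h⁻¹ * y) := by
        rw [MulAction.Quotient.smul_mk, smul_eq_mul]
      rw [hsm, θ_mk, θ_mk, coe_omg, M.theta_act, ← map_mul]
      congr 2
      ext <;> simp

/-- **The three STRUCTURAL laws of the kernel model, in the exact shape of
`Universe.KernelModelThetaData.Structural` (pv15-g2, `KernelModelCarrier.lean`)**, for the triple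
`(SK, omg, θ)` of this model. -/
theorem structural_laws :
    (∀ Φ : M.SK, M.omg 1 Φ = Φ) ∧ Continuous M.θ ∧
      ∀ (h : G) (Φ : M.SK) (ξ : GU ⧸ ΓU) (q : G ⧸ Γ), M.θ (M.omg h Φ) (ξ, q) = M.θ Φ (ξ, h⁻¹ • q) :=
  ⟨M.omg_one, M.θ_cont, M.θ_omg⟩

/-! ## 6. Two by-products the kernel model uses downstream -/

/-- `θ_{ω(h)Φ}` is the translate of `θ_Φ` — as an identity of continuous maps in the second variable. -/
theorem θ_omg_curry (h : G) (Φ : M.SK) (ξ : GU ⧸ ΓU) :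
    (fun q => M.θ (M.omg h Φ) (ξ, q)) = fun q => M.θ Φ (ξ, h⁻¹ • q) :=
  funext fun q => M.θ_omg h Φ ξ q

/-- Joint continuity of `(h, ξ, q) ↦ θ_{ω(h)Φ}(ξ, q)` on `U(W)(𝔸) × [G_U] × [U(W)]` (PerL v5 ll. 394–396, the
shape behind `AX12_transl_cont`): from `θ_omg` and the continuity of the action of `G` on `G ⧸ Γ`. -/
theorem continuous_θ_omg_uncurry (Φ : M.SK) :
    Continuous fun q : G × ((GU ⧸ ΓU) × (G ⧸ Γ)) => M.θ (M.omg q.1 Φ) (q.2.1, q.2.2) := by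
  have heq : (fun q : G × ((GU ⧸ ΓU) × (G ⧸ Γ)) => M.θ (M.omg q.1 Φ) (q.2.1, q.2.2)) =
      fun q => M.θ Φ (q.2.1, q.1⁻¹ • q.2.2) := by
    funext q
    exact M.θ_omg q.1 Φ q.2.1 q.2.2
  rw [heq]
  refine (M.θ Φ).continuous.comp ?_
  exact continuous_snd.fst.prodMk ((continuous_fst.inv).smul continuous_snd.snd)

end WeilThetaModel

end HodgeCM

end
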